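import Literature.Geometry.Lorentzian.OutermostHorizon
import Literature.Geometry.Lorentzian.MinimalSurfaceBarrier
import Literature.Geometry.Lorentzian.HypersurfaceRestriction
import Literature.Geometry.Lorentzian.IsometryProofs
import Literature.Topology.FourManifolds.InverseFunctionTheorem
import Literature.Topology.FourManifolds.SmoothEmbeddingCriteria
import HarnessLib

/-!
# Outermost horizons with smooth normal: the corrected general-horizon Riemannian Penrose
# inequality reduced to Bray's Theorem 19 (family `gr`, statement **gr.S09**; namespace
# `Literature.Geometry.Lorentzian`)

This file closes the gap left open, in prose, in the module docstring of
`OutermostHorizon.lean` (section "The corrected statement", the "two missing steps"): it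
**proves** that the named facts

* `exteriorRegion_structure` (`ExteriorRegion.lean`; Huisken–Ilmanen, J. Differential Geom. 59
  (2001), §4, Lemma 4.1 (i): the exterior component `U = V ∖ K(V)` of the end in a region `V`
  with compact minimal boundary is an exterior region bounded by compact embedded minimal
  spheres),
* `Bray2001_penrose_inequality_exteriorRegion` (`OutermostHorizon.lean`; Bray, J. Differential
  Geom. 59 (2001), Thm. 19, with Huisken–Ilmanen's Lemma 4.1 (ii): `√(|Σ₀|/16π) ≤ m` for every
  compact surface embedded into the boundary of an exterior region), and
* `minimalSurface_boundary_maximumPrinciple` (`ExteriorRegion.lean`; the strong maximum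
  principle for minimal surfaces in boundary form, Andersson–Galloway–Howard 1998, Thm. 3.10 /
  Eschenburg 1989, Thm. 1 — itself proved in `MinimalSurfaceBarrier.lean` from the local
  barrier principle `minimalSurface_barrierPrinciple`)

imply `riemannian_penrose_inequality_smooth` (`OutermostHorizon.lean`), the corrected statement
of the named fact `riemannian_penrose_inequality` of `MassInequalities.lean` (gr.S09, general —
possibly disconnected — horizon, with the outermost hypothesis in the form
`IsMinimalSurfaceFree D.h S.exterior` and a *smooth* unit normal `S.ν`):
`riemannian_penrose_inequality_smooth_of_exteriorRegion` and, with the maximum principle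
discharged, `riemannian_penrose_inequality_smooth_of_barrierPrinciple :
exteriorRegion_structure → Bray2001_penrose_inequality_exteriorRegion →
minimalSurface_barrierPrinciple → riemannian_penrose_inequality_smooth`. The sibling reduction
for the printed outermost hypothesis is `riemannian_penrose_inequality_outermost_of_exteriorRegion`
(`OutermostHorizon.lean`); for the connected horizon,
`riemannian_penrose_inequality_connected_smooth_of_barrierPrinciple`
(`MinimalSurfaceBarrier.lean`).

## The argument (Huisken–Ilmanen 2001, §4, for an outermost horizon)

Let `S` be an outermost minimal surface with smooth unit normal, `V = S.exterior` (connected,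
free of closed minimal surfaces), and `U ⊆ V` the exterior component of the end given by
Lemma 4.1, with compact minimal boundary `∂U = range B.f`. The point is `∂U ⊆ S`
(`OutermostMOTS.range_minimalBoundary_subset_of_isMinimalSurfaceFree`): a boundary point
`p = B.f b ∈ closure U ⊆ V ∪ S` off `S` lies in `V`; the component `N = B.f '' C` of `∂U`
through `p` is the image of a compact connected embedded minimal surface (the restriction of
`B` to the open and closed component `C`, `HypersurfaceRestriction.lean`), so it cannot lie in
`V` (`IsMinimalSurfaceFree.not_image_connectedComponent_subset`) and meets `S` at some
`B.f c = S.f s`; the component `K` of `s` in `S` misses `U ⊆ V` and touches `∂U`, so the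
maximum principle (applied to the restriction of `S` to `K`) puts `S.f '' K` inside `∂U`
(`image_connectedComponent_subset_of_maximumPrinciple`), and then `S.f '' K = N`
(`image_connectedComponent_eq_of_maximumPrinciple`) by the **fill lemma**
`image_connectedComponent_eq_of_subset_range` (the smooth substitute for invariance of domain:
`b⁻¹ ∘ f` is smooth with invertible differential on `K`, hence open by the inverse function
theorem, and `K` is compact). So `p ∈ N ⊆ S`, a contradiction. Hence the connected `V` cannot
cross `∂U`, `U = V` and `∂U = S` (`OutermostMOTS.exterior_eq_of_isMinimalSurfaceFree`), and
Thm. 19 applies to `S` embedded into `∂U`. What remains named below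
`riemannian_penrose_inequality_smooth` is exactly: Lemma 4.1 (i) (minimal-surface theory), the
local barrier principle for minimal surfaces, and Bray's Thm. 19 (conformal flow, Thms. 2–4, 8,
9, 18, Lemma 1, §13), decomposed further in other files. No new definitions and no named facts
are introduced here; used are `HypersurfaceRestriction.lean`, the tree's inverse function
theorem `Literature.Topology.FourManifolds.isLocalDiffeomorphAt_of_mfderiv` and
`Literature.Topology.FourManifolds.contMDiffOn_leftInverse_of_isImmersion`, Mathlib's
`IsLocalHomeomorphOn.map_nhds_eq`, `LinearEquiv.ofInjectiveEndo`, the `connectedComponent` API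
and `ChartedSpace.locallyConnectedSpace`, and `contMDiff_pullbackBilin_holds`
(`IsometryProofs.lean`) for the restricted surfaces.

## References

* H. L. Bray, *Proof of the Riemannian Penrose inequality using the positive mass theorem*,
  J. Differential Geom. 59 (2001) 177–267 (arXiv:math/9911173): Thm. 19 (p. 240; arXiv §13),
  p. 185 before Thm. 1 ("outermost horizons are always strictly outer-minimizing").
* G. Huisken, T. Ilmanen, *The inverse mean curvature flow and the Riemannian Penrose
  inequality*, J. Differential Geom. 59 (2001) 353–437: §4, Lemma 4.1 and its proof.
* L. Andersson, G. J. Galloway, R. Howard, Comm. Pure Appl. Math. 51 (1998) 581–624, Thm. 3.10.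
* M. W. Hirsch, *Differential Topology*, GTM 33, Springer 1976, Ch. 2 §1, Thm. 1.6.
-/

noncomputable section

open Bundle Set Manifold TopologicalSpace Filter Function
open scoped ContDiff Topology ENNReal Manifold Real

namespace Literature.Geometry.Lorentzian

open PseudoRiemannianMetric

/-! ### Compact components inside an embedded surface -/

/-- **Fill lemma: a compact component mapped into an embedded equidimensional submanifold fills
a whole component of it.** Let `f : S₀ → X` be `C^∞` with injective differential, `S₀` compact,
`b : B₀ → X` a smooth embedding with the *same model vector space* `F` (boundaryless models), the
component `K` of `s` mapped into `range b`, and `f s = b y`; then `f '' K = b '' (component of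
`y`)`. Proof: `φ = b⁻¹ ∘ f` is smooth on the open `K` (`contMDiffOn_leftInverse_of_isImmersion`)
with injective, hence invertible, differential (`b ∘ φ = f` near each point), so a local
diffeomorphism there (`isLocalDiffeomorphAt_of_mfderiv`) and `φ '' K` is open; being compact,
connected and `∋ y`, it is the component of `y`. The smooth substitute for invariance of domain in
Huisken–Ilmanen 2001, §4; Hirsch, *Differential Topology* (1976), Ch. 2 §1, proof of Thm. 1.6
(an embedding which is a submersion with closed image onto a connected manifold is onto).
[folklore] -/
theorem image_connectedComponent_eq_of_subset_range
    {F : Type*} [NormedAddCommGroup F] [NormedSpace ℝ F] [CompleteSpace F] [FiniteDimensional ℝ F]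
    {G₁ : Type*} [TopologicalSpace G₁] {I₁ : ModelWithCorners ℝ F G₁} [I₁.Boundaryless]
    {G₂ : Type*} [TopologicalSpace G₂] {I₂ : ModelWithCorners ℝ F G₂} [I₂.Boundaryless]
    {S₀ : Type*} [TopologicalSpace S₀] [ChartedSpace G₁ S₀] [IsManifold I₁ ∞ S₀] [CompactSpace S₀]
    [LocallyConnectedSpace S₀]
    {B₀ : Type*} [TopologicalSpace B₀] [ChartedSpace G₂ B₀] [IsManifold I₂ ∞ B₀] [T2Space B₀]
    {E : Type*} [NormedAddCommGroup E] [NormedSpace ℝ E] {H : Type*} [TopologicalSpace H]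
    {J : ModelWithCorners ℝ E H} {X : Type*} [TopologicalSpace X] [ChartedSpace H X]
    [IsManifold J ∞ X]
    {f : S₀ → X} {b : B₀ → X} (hf : ContMDiff I₁ J ∞ f)
    (hf' : ∀ s, Injective (mfderiv I₁ J f s)) (hb : Manifold.IsSmoothEmbedding I₂ J ∞ b)
    {s : S₀} {y : B₀} (hsy : f s = b y) (hsub : f '' connectedComponent s ⊆ range b) :
    f '' connectedComponent s = b '' connectedComponent y := by
  haveI : Nonempty B₀ := ⟨y⟩
  set K := connectedComponent s with hK
  have hKo : IsOpen K := isOpen_connectedComponent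
  have hKc : IsCompact K := isClosed_connectedComponent.isCompact
  -- the smooth inverse of `b` on its range and `φ = b⁻¹ ∘ f`, smooth on `K`
  have hli : LeftInverse (invFun b) b := leftInverse_invFun hb.isEmbedding.injective
  have hinv : ContMDiffOn J I₂ ∞ (invFun b) (range b) :=
    Literature.Topology.FourManifolds.contMDiffOn_leftInverse_of_isImmersion hb.isImmersion
      hb.isEmbedding hli
  set φ : S₀ → B₀ := invFun b ∘ f with hφ
  have hKf : MapsTo f K (range b) := fun x hx ↦ hsub (mem_image_of_mem f hx)
  have hφK : ContMDiffOn I₁ I₂ ∞ φ K := hinv.comp hf.contMDiffOn hKf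
  have hbφ : ∀ x ∈ K, b (φ x) = f x := fun x hx ↦ invFun_eq (hKf hx)
  have hφs : φ s = y := by
    change invFun b (f s) = y
    rw [hsy, hli y]
  -- `φ` is a local diffeomorphism at the points of `K`
  have hloc : IsLocalDiffeomorphOn I₁ I₂ ∞ φ K := by
    rintro ⟨x, hx⟩
    have hφx : ContMDiffAt I₁ I₂ ∞ φ x := hφK.contMDiffAt (hKo.mem_nhds hx)
    have hdφ : MDifferentiableAt I₁ I₂ φ x := hφx.mdifferentiableAt (by simp)
    have hdb : MDifferentiableAt I₂ J b (φ x) := (hb.contMDiff (φ x)).mdifferentiableAt (by simp)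
    have hev : b ∘ φ =ᶠ[𝓝 x] f :=
      Filter.eventuallyEq_of_mem (hKo.mem_nhds hx) fun x' hx' ↦ hbφ x' hx'
    have hcomp : (mfderiv I₂ J b (φ x)).comp (mfderiv I₁ I₂ φ x) = mfderiv I₁ J f x := by
      rw [← mfderiv_comp x hdb hdφ, hev.mfderiv_eq]
    have hinj : Injective (mfderiv I₁ I₂ φ x) := by
      refine Injective.of_comp (f := mfderiv I₂ J b (φ x)) ?_
      rw [← ContinuousLinearMap.coe_comp, hcomp]
      exact hf' x
    -- an injective endomorphism of the finite-dimensional model space is an isomorphism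
    set L : F ≃L[ℝ] F := LinearEquiv.toContinuousLinearEquiv
      (LinearEquiv.ofInjectiveEndo (mfderiv I₁ I₂ φ x).toLinearMap hinj) with hL
    refine Literature.Topology.FourManifolds.isLocalDiffeomorphAt_of_mfderiv hKo hx hφK
      (by simp) L ?_
    ext v
    rfl
  -- hence `φ '' K` is open; it is compact, connected and contains `y`
  have hφKo : IsOpen (φ '' K) := by
    rw [isOpen_iff_mem_nhds]
    rintro _ ⟨x, hx, rfl⟩
    rw [← hloc.isLocalHomeomorphOn.map_nhds_eq hx]
    exact image_mem_map (hKo.mem_nhds hx)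
  have hφKc : IsClosed (φ '' K) := (hKc.image_of_continuousOn hφK.continuousOn).isClosed
  have hφKconn : IsPreconnected (φ '' K) :=
    isPreconnected_connectedComponent.image φ hφK.continuousOn
  have hyφK : y ∈ φ '' K := ⟨s, mem_connectedComponent, hφs⟩
  have hφKeq : φ '' K = connectedComponent y :=
    (hφKconn.subset_connectedComponent hyφK).antisymm
      (IsClopen.connectedComponent_subset ⟨hφKc, hφKo⟩ hyφK)
  -- and `f '' K = b '' (φ '' K)`
  rw [← hφKeq, ← image_comp]
  exact (image_congr fun x hx ↦ (hbφ x hx).symm)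

/-! ### Components of minimal boundaries -/

section Components

variable {X : Type} [TopologicalSpace X] [ChartedSpace E3 X] [IsManifold (𝓡 3) ∞ X]
  {h : ContMDiffRiemannianMetric (𝓡 3) ∞ E3 (TangentSpace (𝓡 3) : X → Type _)}
  [(ofRiemannian h).HasLeviCivita]

/-- **A region free of closed minimal surfaces contains no component of a compact minimal
boundary** (Huisken–Ilmanen 2001, §4: the boundary spheres of the exterior region are compact
minimal surfaces). If `B` is a compact minimal boundary (of any region) with smooth unit normal,
the image `B.f '' C` of a connected component `C` of its surface type is the image of the
compact embedded minimal surface `B.f|_C` (`HypersurfaceRestriction.lean`: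
`IsMaximalSlice.comp_subtypeVal` etc., `C` being open and closed in `B.surf`), which
`IsMinimalSurfaceFree h V` forbids to lie in `V`. [cite: HuiskenIlmanenIMCF2001, §4, Lemma 4.1 (i)] -/
theorem IsMinimalSurfaceFree.not_image_connectedComponent_subset {V : Opens X}
    (hV : IsMinimalSurfaceFree h V) {U : Set X} (B : MinimalBoundary h U) (b : B.surf) :
    ¬ B.f '' connectedComponent b ⊆ (V : Set X) := by
  intro hsub
  haveI := ChartedSpace.locallyConnectedSpace (EuclideanSpace ℝ (Fin 2)) B.surf
  let W : Opens B.surf := ⟨connectedComponent b, isOpen_connectedComponent⟩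
  haveI : CompactSpace W :=
    isCompact_iff_compactSpace.mp (isClosed_connectedComponent (x := b)).isCompact
  have hd : ∀ y, MDifferentiableAt (𝓡 2) (𝓡 3) B.f y := fun y ↦
    (B.isSpacelikeImmersion.contMDiff y).mdifferentiableAt (by simp)
  refine hV W (B.f ∘ Subtype.val) (fun y ↦ B.ν y.1) contMDiff_pullbackBilin_holds
    B.isSpacelikeImmersion.comp_subtypeVal (isSmoothEmbedding_comp_subtypeVal B.isEmbedding) ?_
    (B.isUnitNormal.comp_subtypeVal hd) ⟨⟨b, mem_connectedComponent⟩⟩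
    (B.isMinimal.comp_subtypeVal contMDiff_pullbackBilin_holds)
  rintro _ ⟨y, rfl⟩
  exact hsub ⟨y.1, y.2, rfl⟩

/-- **The boundary maximum principle, componentwise** (Huisken–Ilmanen 2001, §4, proof of
Lemma 4.1, from the strong maximum principle for minimal surfaces, Andersson–Galloway–Howard
1998, Thm. 3.10, vendored as `minimalSurface_boundary_maximumPrinciple`, `ExteriorRegion.lean`).
Let `U ⊆ X` be open with compact minimal boundary `∂U = range B.f`, and `B'` another compact
minimal boundary (of any region) with smooth unit normal whose image misses `U`. If
`B'.f s ∈ ∂U`, the component `K` of `s` satisfies `B'.f '' K ⊆ ∂U`: the named fact applied to the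
compact connected embedded minimal surface `B'.f|_K` (`HypersurfaceRestriction.lean`).
[cite: HuiskenIlmanenIMCF2001, §4, Lemma 4.1 (i)] [cite: AnderssonGallowayHoward1998, Thm. 3.10] -/
theorem image_connectedComponent_subset_of_maximumPrinciple [T2Space X]
    [SecondCountableTopology X] (h5 : minimalSurface_boundary_maximumPrinciple)
    {U : Opens X} (B : MinimalBoundary h (U : Set X)) {V : Set X} (B' : MinimalBoundary h V)
    (hdisj : Disjoint (range B'.f) (U : Set X)) (s : B'.surf) (hs : B'.f s ∈ range B.f) :
    B'.f '' connectedComponent s ⊆ range B.f := by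
  haveI := ChartedSpace.locallyConnectedSpace (EuclideanSpace ℝ (Fin 2)) B'.surf
  let W : Opens B'.surf := ⟨connectedComponent s, isOpen_connectedComponent⟩
  haveI : CompactSpace W :=
    isCompact_iff_compactSpace.mp (isClosed_connectedComponent (x := s)).isCompact
  haveI : ConnectedSpace W := Subtype.connectedSpace isConnected_connectedComponent
  have hd : ∀ y, MDifferentiableAt (𝓡 2) (𝓡 3) B'.f y := fun y ↦
    (B'.isSpacelikeImmersion.contMDiff y).mdifferentiableAt (by simp)
  have hrange : range (B'.f ∘ Subtype.val : W → X) = B'.f '' connectedComponent s := by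
    rw [range_comp, Subtype.range_coe_subtype]
    rfl
  have key := h5 X h U B W (B'.f ∘ Subtype.val) (fun y ↦ B'.ν y.1) contMDiff_pullbackBilin_holds
    B'.isSpacelikeImmersion.comp_subtypeVal (isSmoothEmbedding_comp_subtypeVal B'.isEmbedding)
    (B'.isUnitNormal.comp_subtypeVal hd) (contMDiff_normal_comp_subtypeVal B'.contMDiff_normal)
    (B'.isMinimal.comp_subtypeVal contMDiff_pullbackBilin_holds)
    (hdisj.mono_left (hrange ▸ image_subset_range _ _))
    ⟨B'.f s, hrange ▸ ⟨s, mem_connectedComponent, rfl⟩, hs⟩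
  rwa [hrange] at key

/-- **Touching components of two compact minimal boundaries coincide** (Huisken–Ilmanen 2001,
§4): in the situation of `image_connectedComponent_subset_of_maximumPrinciple`, with
`B'.f s = B.f c`, `B'.f '' connectedComponent s = B.f '' connectedComponent c` (maximum
principle, then the fill lemma `image_connectedComponent_eq_of_subset_range`).
[cite: HuiskenIlmanenIMCF2001, §4, Lemma 4.1 (i)] -/
theorem image_connectedComponent_eq_of_maximumPrinciple [T2Space X]
    [SecondCountableTopology X] (h5 : minimalSurface_boundary_maximumPrinciple)
    {U : Opens X} (B : MinimalBoundary h (U : Set X)) {V : Set X} (B' : MinimalBoundary h V)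
    (hdisj : Disjoint (range B'.f) (U : Set X)) {s : B'.surf} {c : B.surf}
    (hsc : B'.f s = B.f c) :
    B'.f '' connectedComponent s = B.f '' connectedComponent c := by
  haveI := ChartedSpace.locallyConnectedSpace (EuclideanSpace ℝ (Fin 2)) B'.surf
  exact image_connectedComponent_eq_of_subset_range B'.isSpacelikeImmersion.contMDiff_self
    B'.isSpacelikeImmersion.injective_mfderiv B.isEmbedding hsc
    (image_connectedComponent_subset_of_maximumPrinciple h5 B B' hdisj s ⟨c, hsc.symm⟩)

end Components

/-! ### The exterior of an outermost horizon with smooth normal is the exterior region -/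

section Reduction

variable {X : Type} [TopologicalSpace X] [ChartedSpace E3 X] [IsManifold (𝓡 3) ∞ X]
  [T2Space X] [SecondCountableTopology X]

/-- **The boundary of an exterior region inside the exterior of an outermost horizon lies on the
horizon** (the two "missing steps" of the module docstring of `OutermostHorizon.lean`, section
"The corrected statement", now proved). Let `S` be an outermost minimal surface of
time-symmetric data with *smooth* unit normal, `V = S.exterior` free of closed minimal surfaces
(`IsMinimalSurfaceFree`), and `U ⊆ V` an open region with compact minimal boundary
`∂U = range B.f` (smooth normal). Then `∂U ⊆ S`: a point `p = B.f b ∈ ∂U ⊆ closure V = V ∪ S`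
not on `S` lies in `V`; the component `N = B.f '' C` of `∂U` through `p` cannot lie in `V`
(`IsMinimalSurfaceFree.not_image_connectedComponent_subset`), so it meets `S` at some
`B.f c = S.f s`; the component of `s` in `S` misses `U ⊆ V` and touches `∂U`, so by the maximum
principle and the fill lemma it *is* `N` (`image_connectedComponent_eq_of_maximumPrinciple`),
whence `p ∈ N ⊆ S`, a contradiction. Huisken–Ilmanen 2001, §4 (boundary spheres of the exterior
region versus the given minimal boundary). [cite: HuiskenIlmanenIMCF2001, §4, Lemma 4.1 (i)] -/
theorem OutermostMOTS.range_minimalBoundary_subset_of_isMinimalSurfaceFree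
    (h5 : minimalSurface_boundary_maximumPrinciple)
    {h : ContMDiffRiemannianMetric (𝓡 3) ∞ E3 (TangentSpace (𝓡 3) : X → Type _)}
    [(ofRiemannian h).HasLeviCivita] (S : OutermostMOTS (𝓡 3) h 0)
    (hν : ContMDiff (𝓡 2) (𝓡 3).tangent ∞
      (fun y ↦ (TotalSpace.mk' E3 (S.f y) (S.ν y) : TangentBundle (𝓡 3) X)))
    (hfree : IsMinimalSurfaceFree h S.exterior) {U : Opens X}
    (B : MinimalBoundary h (U : Set X)) (hUV : (U : Set X) ⊆ (S.exterior : Set X)) :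
    range B.f ⊆ range S.f := by
  rintro _ ⟨b, rfl⟩
  by_contra hpS
  -- `p = B.f b ∈ closure U ⊆ closure V = V ∪ S`, so `p ∈ V`
  have hclos : closure (U : Set X) ⊆ (S.exterior : Set X) ∪ range S.f := by
    refine (closure_mono hUV).trans ?_
    rw [closure_eq_self_union_frontier, S.frontier_exterior]
  have hpV : B.f b ∈ (S.exterior : Set X) :=
    (hclos (B.range_subset_closure ⟨b, rfl⟩)).resolve_right hpS
  -- the component of `∂U` through `p` meets `S`
  obtain ⟨_, ⟨c, hc, rfl⟩, hcV⟩ :=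
    Set.not_subset.1 (hfree.not_image_connectedComponent_subset B b)
  have hcS : B.f c ∈ range S.f :=
    (hclos (B.range_subset_closure ⟨c, rfl⟩)).resolve_left hcV
  obtain ⟨s, hs⟩ := hcS
  -- the component of `s` in `S` coincides with the component of `c` in `∂U`
  have hdisj : Disjoint (range (S.toMinimalBoundary hν).f) (U : Set X) := by
    rw [S.toMinimalBoundary_f, Set.disjoint_iff_inter_eq_empty, ← Set.subset_empty_iff,
      ← S.range_inter_exterior]
    exact inter_subset_inter_right _ hUV
  have heq := image_connectedComponent_eq_of_maximumPrinciple h5 B (S.toMinimalBoundary hν)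
    hdisj (s := s) (c := c) hs
  -- so `p ∈ B.f '' C = S.f '' K ⊆ range S.f`
  have hbc : b ∈ connectedComponent c := by
    rw [← connectedComponent_eq hc]
    exact mem_connectedComponent
  have hp : B.f b ∈ B.f '' connectedComponent c := ⟨b, hbc, rfl⟩
  rw [← heq] at hp
  exact hpS (image_subset_range _ _ hp)

/-- **The exterior of an outermost horizon with smooth normal is the exterior region of the
end** (Huisken–Ilmanen 2001, §4, Lemma 4.1 (i), read for an outermost horizon; the analogue of
`OutermostMOTS.exterior_eq_of_outermost` with the printed outermost hypothesis replaced by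
`IsMinimalSurfaceFree` plus smoothness of `S.ν`). With `S`, `V = S.exterior` as in
`OutermostMOTS.range_minimalBoundary_subset_of_isMinimalSurfaceFree`, `V` connected and
`U ⊆ V` open, nonempty, with compact minimal boundary `B`: `U = V` and `∂U = S` (since
`∂U ⊆ S` misses `V`, the connected `V ⊇ U` lies in `U`).
[cite: HuiskenIlmanenIMCF2001, §4, Lemma 4.1 (i)] -/
theorem OutermostMOTS.exterior_eq_of_isMinimalSurfaceFree
    (h5 : minimalSurface_boundary_maximumPrinciple)
    {h : ContMDiffRiemannianMetric (𝓡 3) ∞ E3 (TangentSpace (𝓡 3) : X → Type _)}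
    [(ofRiemannian h).HasLeviCivita] (S : OutermostMOTS (𝓡 3) h 0)
    (hν : ContMDiff (𝓡 2) (𝓡 3).tangent ∞
      (fun y ↦ (TotalSpace.mk' E3 (S.f y) (S.ν y) : TangentBundle (𝓡 3) X)))
    (hfree : IsMinimalSurfaceFree h S.exterior) (hconn : IsConnected (S.exterior : Set X))
    {U : Opens X} (B : MinimalBoundary h (U : Set X)) (hUV : (U : Set X) ⊆ (S.exterior : Set X))
    (hne : (U : Set X).Nonempty) :
    (U : Set X) = (S.exterior : Set X) ∧ range B.f = range S.f := by
  have hBS : range B.f ⊆ range S.f :=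
    S.range_minimalBoundary_subset_of_isMinimalSurfaceFree h5 hν hfree B hUV
  have hfr : Disjoint (S.exterior : Set X) (frontier (U : Set X)) := by
    rw [B.frontier_eq]
    refine Set.disjoint_left.2 fun x hxV hxB ↦ ?_
    have hx : x ∈ range S.f ∩ (S.exterior : Set X) := ⟨hBS hxB, hxV⟩
    rw [S.range_inter_exterior] at hx
    exact hx
  have hVU : (S.exterior : Set X) ⊆ (U : Set X) :=
    subset_of_isPreconnected_of_frontier_disjoint hconn.isPreconnected U.isOpen hUV hne hfr
  have hUVeq : (U : Set X) = (S.exterior : Set X) := hUV.antisymm hVU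
  refine ⟨hUVeq, ?_⟩
  rw [← S.frontier_exterior, ← B.frontier_eq, hUVeq]

/-! ### Reduction of the corrected general-horizon Penrose inequality to Bray's Theorem 19 -/

/-- **gr.S09, general horizon (corrected statement): the reduction to Bray's Theorem 19,
proved.** The named facts `exteriorRegion_structure` (Huisken–Ilmanen 2001, Lemma 4.1 (i),
`ExteriorRegion.lean`), `Bray2001_penrose_inequality_exteriorRegion` (Bray 2001, Thm. 19, with
Huisken–Ilmanen's Lemma 4.1 (ii), `OutermostHorizon.lean`) and
`minimalSurface_boundary_maximumPrinciple` (the strong maximum principle for minimal surfaces,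
boundary form, `ExteriorRegion.lean`) imply `riemannian_penrose_inequality_smooth`, the corrected
form of `riemannian_penrose_inequality` (`MassInequalities.lean`). Proof: let `V = S.exterior`
with minimal boundary `S` (`OutermostMOTS.toMinimalBoundary`, by smoothness of `S.ν`);
Lemma 4.1 gives the exterior component `U = V ∖ K(V)` of the end `e`, an exterior region
(`IsExteriorRegion e U`) with compact minimal boundary `B` and no compact minimal surface in
`closure U` off `∂U` (`subset_frontier_of_isMinimalSurfaceImage`); by
`OutermostMOTS.exterior_eq_of_isMinimalSurfaceFree` (maximum principle + fill lemma +
`IsMinimalSurfaceFree`), `U = V` and `∂U = S`; Thm. 19 for `U`, applied to the compact surface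
`S.surf` embedded into `∂U` by `S.f`, is the claim (`S.surfaceArea = totalArea (S.f^* h)` by
definition). [cite: BrayRPI2001, Thm. 19 (p. 240)] [cite: HuiskenIlmanenIMCF2001, §4, Lemma 4.1] -/
theorem riemannian_penrose_inequality_smooth_of_exteriorRegion
    (h1 : exteriorRegion_structure) (h2 : Bray2001_penrose_inequality_exteriorRegion)
    (h5 : minimalSurface_boundary_maximumPrinciple) :
    riemannian_penrose_inequality_smooth := by
  intro X _ _ _ _ _ _ D _ e S hν _hts hR hAF hRq hcomp hADM hfree hext
  -- the exterior `V = S.exterior` with its minimal boundary `S`, and its exterior component `U`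
  obtain ⟨-, U, B, hUV, hUext, -⟩ := h1 X D e S.exterior (S.toMinimalBoundary hν)
    hcomp hext hAF.isMetricAsymptoticallyFlat
  have hUV' : (U : Set X) ⊆ (S.exterior : Set X) := hUV ▸ sdiff_subset
  -- `U = V` and `∂U = S`
  obtain ⟨-, hBS⟩ := S.exterior_eq_of_isMinimalSurfaceFree h5 hν hfree hext.isConnected B hUV'
    hUext.nonempty
  -- no other compact minimal surfaces in `closure U`
  have hiii : ∀ N, IsMinimalSurfaceImage D.h N → N ⊆ closure (U : Set X) → N ⊆ range B.f := by
    intro N hN hNU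
    rw [← B.frontier_eq]
    exact subset_frontier_of_isMinimalSurfaceImage U.isOpen hUV hN hNU
  -- Thm. 19 for the exterior region `U`, applied to `S` embedded into `∂U`
  exact h2 X D e U B hcomp hUext hAF.isMetricAsymptoticallyFlat hRq hADM (fun x _ ↦ hR x) hiii
    S.surf S.f S.hpb S.isSpacelikeImmersion S.isEmbedding hBS.ge

/-- **gr.S09, general horizon (corrected statement), with the maximum principle discharged from
the barrier principle**: `exteriorRegion_structure → Bray2001_penrose_inequality_exteriorRegion →
minimalSurface_barrierPrinciple → riemannian_penrose_inequality_smooth`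
(`riemannian_penrose_inequality_smooth_of_exteriorRegion` with
`minimalSurface_boundary_maximumPrinciple_of_barrierPrinciple` of `MinimalSurfaceBarrier.lean`).
The remaining named facts are: Huisken–Ilmanen's Lemma 4.1 (i) (existence and structure of the
exterior region), Bray's Thm. 19 with Lemma 4.1 (ii), and the local barrier (tangency) principle
for minimal surfaces. [cite: BrayRPI2001, Thm. 19 (p. 240)]
[cite: HuiskenIlmanenIMCF2001, §4, Lemma 4.1] -/
theorem riemannian_penrose_inequality_smooth_of_barrierPrinciple
    (h1 : exteriorRegion_structure) (h2 : Bray2001_penrose_inequality_exteriorRegion)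
    (hbar : minimalSurface_barrierPrinciple) : riemannian_penrose_inequality_smooth :=
  riemannian_penrose_inequality_smooth_of_exteriorRegion h1 h2
    (minimalSurface_boundary_maximumPrinciple_of_barrierPrinciple hbar)

end Reduction

end Literature.Geometry.Lorentzian

end
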